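import Summits.QuantumFields.BalabanUV.T4Continuum.Spine.NE2BalabanClosure
import Summits.QuantumFields.BalabanUV.T4Continuum.Spine.NE2BalabanLayerSharp
import Summits.QuantumFields.BalabanUV.T4Continuum.Support.CovariantBlockAveragingPairingLaw
import Summits.QuantumFields.BalabanUV.T4Continuum.Support.RegularTransportersContour

/-!
# T⁴ programme, spine node NE2 (U1a), tier B row B7 (ASSEMBLY) — WIRING: the transport-error laws `hE` of ROOT B DISCHARGED from the
# regularity class and node NE3 BY NAME, and the SHARP `t = 1` face (no smallness asked of NE3's constant)

NE2 formalisation swarm `b2b-balaban-t4-ne2-formalise-*`, leaf prover 08 (row B7 of `t4/formal/NE2/LEAVES.md`, CLAIMS l.5490), PART 2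
file 5.  Inputs, all BY NAME: `Spine/NE2BalabanClosure` (leaf-08: `perturbationLaws_gaugeSlot_balaban`, `perturbationLaws_balaban_closure`),
`Spine/NE2BalabanLayerSharp` (leaf-03: `perturbationLaws_balaban_sharp`, `balaban_rate_of_small_sharp`, `kappaBs`, `C2Bs`, `KstarR`),
`Support/CovariantBlockAveragingPairingLaw` (leaf-07, row B3.b-conc (iii): `averagingLaws_Ecov_of_bond`),
`Support/RegularTransportersPerBond` / `Support/RegularTransportersContour` (leaf-03, row B5 feed: `norm_transporter_sub_one_le`,
`transport_contour_two_level_of_regular`), `Support/NestedContourTransportContour` (leaf-06, row B3.b-conc (ii): `thetaC`).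

WHAT THIS FILE DOES (bookkeeping, model level).
* §1 `thetaR o d L α C k := thetaC L n_k d (α/(L n_k)) (α/n_k) (βNE3/(L n_k²))` — the two-level consistency of the contour transporters
  of a background in the (3.35)-shape regularity class `RegularTransporters L M R α β` whose coefficient towers `{w, Dw}` obey node
  NE3's `LocalRate … C L⁻¹` (leaf-03's instantiation of leaf-06's constant); `thetaR_nonneg`; **`averagingLaws_Ecov_of_regular`**: the
  `hE` binder of `perturbationLaws_balaban` — `AveragingLaws (Δ_a ⊗ 1) (Ecov L M R) (J ⊗ 1) ε (Cδ·L^{−k})` with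
  `ε = card o·(e^{(d+1)α} − 1)`, `Cδ = Cst·card o·(θ₀ + e^{(d+1)α} − 1)` — from `hreg`, `hNE3` and ONE displayed numeric bound
  `hθg : thetaR … k ≤ θ₀·L^{−k}` (leaf-06's `thetaC_le_theta0_div`, row B3.b-conc (ii) file 3, supplies it; until that file is in the
  tree it is a binder on numbers, not on operators).
* §2 the SHARP faces of the closure: `perturbationLaws_balaban_closure_sharp`, `balaban_closure_rate_of_small_sharp` — leaf-03's
  `…_sharp` theorems with the gauge slot `hP₄ := perturbationLaws_gaugeSlot_balaban`; the idle binder `hCη : C ≤ η` is GONE.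
* §3 **`perturbationLaws_balaban_wired`** / **`balaban_wired_rate_of_small`**: §2 with `hE := averagingLaws_Ecov_of_regular`.  ROOT B for
  Bałaban's typed operator now displays ONLY: `hreg` (row B5's class of the lifted site transporters `liftR L M Rg`, c3), `hNE3` (node
  NE3 BY NAME on `regClass (liftR Rg) = {w, Dw}`, c2/c7), `hθg` (numeric, see §1), the scalar tower's `FreeTowerLaws` (row B4.d) and
  `PerturbationLaws` (row B4.e), the connection / site-transporter sizes and geometric bounds of row B4.b's END, `σ₀⁻²·δK < 1`, and the
  small-field threshold `η·KstarR(card o, d, a) < 1` with `α₅, β₅, ε, κ₄ ≤ η ≤ 1`.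

HONEST FRAMING (T4-DAG p. 1).  Re-assembly BY NAME at MODEL LEVEL: transporters, site transporters and the scalar tower's laws are
DATA / HYPOTHESES in the tree's shapes; no assertion that they are Bałaban's minimisers `U_k(V)` (no B0, c5); GLOBAL small field; finite
torus, linear layer, operator norm.  ROOT B stays CONDITIONAL as displayed — in particular on node NE3 (OPEN) — NOT [B9] (3.23)–(3.26)
as printed; NE2 (U1a) is NOT PROVED by this file (c1 with the carver); spine PROVED count 0/9 unchanged; NOT infinite volume / mass gap
/ Clay.  HONEST DEPENDENCY: continuum YM on T⁴ ⇐ BetaPertH ∧ nine spine estimates (0/9 proved); BetaPertH ⇐ (D1) ∧ (D4) ∧ CAP+tail;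
G-an2-4 gates asym, D1 and NE2/3/4.  ABSOLUTE RULE: no internally-minted statement enters as a cited fact; every `[cite:]` tag below is
a SHAPE locator; no `def … : Prop` fact; no `sorry`.
-/

noncomputable section

open scoped BigOperators ComplexConjugate Matrix Matrix.Norms.L2Operator Kronecker
open Filter Topology

namespace Summit.QuantumFields.BalabanUV.T4Continuum.NE2BalabanWiring

open Literature.MathematicalPhysics.QuantumFieldTheory.Balaban1983to89.B5Prop11Plancherel (Cst Cst_nonneg Tor fine)
open Literature.MathematicalPhysics.QuantumFieldTheory.Balaban1983to89.B5G183RateUnitTower (lev lev_neZero)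
open Literature.MathematicalPhysics.QuantumFieldTheory.Balaban1983to89.T4EtaRateMin (LocalRate)
open Summit.QuantumFields.BalabanUV.T4Continuum
open Summit.QuantumFields.BalabanUV.T4Continuum.CovariantAveragingTower (TowerLimitRate)
open Summit.QuantumFields.BalabanUV.T4Continuum.BalabanAveragedTowerUnit (idx Qlev)
open Summit.QuantumFields.BalabanUV.T4Continuum.BackgroundResolventTower
open Summit.QuantumFields.BalabanUV.T4Continuum.KingPairingPlantedLaw
open Summit.QuantumFields.BalabanUV.T4Continuum.PerturbationAlgebra
open Summit.QuantumFields.BalabanUV.T4Continuum.GramPerturbationLaw (AveragingLaws C2gram)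
open Summit.QuantumFields.BalabanUV.T4Continuum.NE2FromNE3 (bgReadings)
open Summit.QuantumFields.BalabanUV.T4Continuum.RegularBackgroundTower (RegularTransporters regClass betaNE3)
open Summit.QuantumFields.BalabanUV.T4Continuum.RegularTransportersPerBond (norm_transporter_sub_one_le)
open Summit.QuantumFields.BalabanUV.T4Continuum.RegularTransportersContour (transport_contour_two_level_of_regular)
open Summit.QuantumFields.BalabanUV.T4Continuum.NestedContourTransport (thetaC ThetaC_nonneg xiC_nonneg one_le_Bl)
open Summit.QuantumFields.BalabanUV.T4Continuum.CovariantBlockAveraging (Ecov averagingLaws_Ecov_of_bond)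
open Summit.QuantumFields.BalabanUV.T4Continuum.CovariantAveragingSummand (kappaQ)
open Summit.QuantumFields.BalabanUV.T4Continuum.BlockMultiplication (siteMul)
open Summit.QuantumFields.BalabanUV.T4Continuum.BlockPairingGeometry (tau parT)
open Summit.QuantumFields.BalabanUV.T4Continuum.BalabanAveragedTowerModes (par)
open Summit.QuantumFields.BalabanUV.T4Continuum.GaugeTermDecomposition (connL)
open Summit.QuantumFields.BalabanUV.T4Continuum.GaugeTermSandwichLaw
open Summit.QuantumFields.BalabanUV.T4Continuum.GaugeTermLayer
open Summit.QuantumFields.BalabanUV.T4Continuum.GaugeTermPerturbationLaw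
open Summit.QuantumFields.BalabanUV.T4Continuum.GaugeTermScalarData (QuT Q1 J0)
open Summit.QuantumFields.BalabanUV.T4Continuum.ScalarAveragedPropagator (DeltaPs)
open Summit.QuantumFields.BalabanUV.T4Continuum.ScalarCovariantLaplacian (scalarPert)
open Summit.QuantumFields.BalabanUV.T4Continuum.NE2BalabanLayer
open Summit.QuantumFields.BalabanUV.T4Continuum.NE2BalabanRoot
open Summit.QuantumFields.BalabanUV.T4Continuum.NE2BalabanGauge
open Summit.QuantumFields.BalabanUV.T4Continuum.NE2BalabanClosure
open Summit.QuantumFields.BalabanUV.T4Continuum.NE2BalabanLayerSharp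

variable {d : ℕ} (L : ℕ) [NeZero L] (M : Fin d → ℕ) [hM : ∀ μ, NeZero (M μ)] (a : ℝ) (ha : 0 < a)
variable {o : Type*} [Fintype o] [DecidableEq o]

/-! ## §1 The transport-error laws of `Ecov` from the regularity class and node NE3 -/

/-- **THE TWO-LEVEL CONSISTENCY OF THE CONTOUR TRANSPORTERS OF A REGULAR BACKGROUND** (leaf-06's `thetaC` at leaf-03's arguments):
`θ_k = thetaC L n_k d (α/(L n_k)) (α/n_k) (βNE3(C)/(L n_k²))`. [folklore] -/
def thetaR (o : Type*) [Fintype o] (d L : ℕ) (α C : ℝ) (k : ℕ) : ℝ :=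
  thetaC L (lev L k) d (α / ((L : ℝ) * (lev L k : ℕ))) (α / (lev L k : ℕ)) (betaNE3 o C / ((L : ℝ) * ((lev L k : ℕ) : ℝ) ^ 2))

omit [NeZero L] hM [DecidableEq o] in
/-- `θ_k ≥ 0` for `α, C ≥ 0`. [folklore] -/
theorem thetaR_nonneg {α C : ℝ} (hα : 0 ≤ α) (hC : 0 ≤ C) (k : ℕ) : 0 ≤ thetaR o d L α C k := by
  have ha' : 0 ≤ α / ((L : ℝ) * (lev L k : ℕ)) := by positivity
  have ha1 : 0 ≤ α / (lev L k : ℕ) := by positivity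
  have hb : 0 ≤ betaNE3 o C / ((L : ℝ) * ((lev L k : ℕ) : ℝ) ^ 2) := by unfold betaNE3; positivity
  have hB := one_le_Bl (L := L) (n := lev L k) ha' ha1
  have hT := ThetaC_nonneg (L := L) (n := lev L k) ha' ha1 hb
  have hx := xiC_nonneg (L := L) ha'
  unfold thetaR thetaC
  exact mul_nonneg (pow_nonneg (zero_le_one.trans hB) _)
    (add_nonneg (add_nonneg (mul_nonneg (by positivity) hT) (mul_nonneg zero_le_two hx)) ha1)

/-- the size `ε = card o·(e^{(d+1)α} − 1)` of the transport error `E_k` (leaf-07's `opNorm_Ecov_le`). [folklore] -/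
def epsR (o : Type*) [Fintype o] (d : ℕ) (α : ℝ) : ℝ := Fintype.card o * (Real.exp ((d + 1 : ℕ) * α) - 1)

/-- the pairing constant `Cδ = Cst·card o·(θ₀ + e^{(d+1)α} − 1)` of the transport error (leaf-07's `averagingLaws_Ecov_of_bond`).
[folklore] -/
def CdeltaR (o : Type*) [Fintype o] (d : ℕ) (a α θ₀ : ℝ) : ℝ :=
  Cst d a * Fintype.card o * (θ₀ + (Real.exp ((d + 1 : ℕ) * α) - 1))

omit [DecidableEq o] in
/-- `ε ≥ 0` for `α ≥ 0`. [folklore] -/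
theorem epsR_nonneg {α : ℝ} (hα : 0 ≤ α) : 0 ≤ epsR o d α :=
  mul_nonneg (Nat.cast_nonneg _) (sub_nonneg.mpr (Real.one_le_exp (by positivity)))

/-- **THE `hE` BINDER OF ROOT B FROM THE REGULARITY CLASS AND NODE NE3 BY NAME**: for transporters in row B5's class whose coefficient
towers `{w, Dw}` obey node NE3's `LocalRate … C L⁻¹`, and the numeric geometric bound `θ_k ≤ θ₀·L^{−k}` on §1's consistency constant,
`AveragingLaws (Δ_a ⊗ 1) (Ecov L M R) (J ⊗ 1) ε (Cδ·L^{−k})` with `ε = epsR o d α`, `Cδ = CdeltaR o d a α θ₀` — leaf-07's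
`averagingLaws_Ecov_of_bond` fed by leaf-03's `norm_transporter_sub_one_le` and `transport_contour_two_level_of_regular`.  `hNE3` is a
displayed binder (node NE3 OPEN); NE2 is NOT proved by this. [cite: Balaban1985BackgroundPropagators, (3.19) p.393 (shape)] [folklore] -/
theorem averagingLaws_Ecov_of_regular {R : (k : ℕ) → Fin d → (idx L M k → Matrix o o ℂ)} {α β : ℝ}
    (hreg : RegularTransporters L M R α β) {C : ℝ} (hC : 0 ≤ C) (hNE3 : LocalRate (bgReadings L M (regClass L M R)) C ((L : ℝ)⁻¹))
    {θ₀ : ℝ} (hθg : ∀ k, thetaR o d L α C k ≤ θ₀ * ((L : ℝ)⁻¹) ^ k) :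
    AveragingLaws (fun k => calDalev L M a ha k ⊗ₖ (1 : Matrix o o ℂ)) (Ecov L M R) (fun k => JpcT L M k ⊗ₖ (1 : Matrix o o ℂ))
      (epsR o d α) (fun k => CdeltaR o d a α θ₀ * ((L : ℝ)⁻¹) ^ k) :=
  averagingLaws_Ecov_of_bond L M a ha hreg.nonneg.1 (fun k ν i => norm_transporter_sub_one_le hreg k ν i)
    (thetaR_nonneg L (o := o) (d := d) hreg.nonneg.1 hC) hθg
    (fun k y μ j r t' ht' => transport_contour_two_level_of_regular hreg hC hNE3 k y μ j r t' ht')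

/-! ## §2 The sharp faces of the closure (no smallness asked of NE3's constant) -/

/-- **`perturbationLaws_balaban_closure`, SHARP `κ`** (leaf-03's `perturbationLaws_balaban_sharp` with the gauge slot discharged by
`perturbationLaws_gaugeSlot_balaban`): `κ = kappaBs o d a α₅ β₅ (kappaQ d a a ε) (kappa4S …)` — NE3's constant `C` enters `C₂` only.
Binders as in `NE2BalabanClosure.perturbationLaws_balaban_closure`.  NE2 is NOT proved by this. [folklore] -/
theorem perturbationLaws_balaban_closure_sharp (hd : 1 ≤ d) {Rg : (k : ℕ) → Fin d → (Tor (fine (lev L k) M) → Matrix o o ℂ)}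
    {α₅ β₅ : ℝ} (hreg : RegularTransporters L M (liftR L M Rg) α₅ β₅) {C : ℝ} (hC : 0 ≤ C)
    (hNE3 : LocalRate (bgReadings L M (regClass L M (liftR L M Rg))) C ((L : ℝ)⁻¹)) {ε Cδ : ℝ} (hε : 0 ≤ ε)
    (hE : AveragingLaws (fun k => calDalev L M a ha k ⊗ₖ (1 : Matrix o o ℂ)) (Ecov L M (liftR L M Rg))
      (fun k => JpcT L M k ⊗ₖ (1 : Matrix o o ℂ)) ε (fun k => Cδ * ((L : ℝ)⁻¹) ^ k))
    {T : (k : ℕ) → Tor (fine (lev L k) M) → Matrix o o ℂ} {a' : ℝ} (ha' : 0 < a')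
    {A : (k : ℕ) → Matrix (Tor (fine (lev L k) M) × o) (Tor (fine (lev L (k + 1)) M) × o) ℂ}
    {F : (k : ℕ) → Matrix (Tor (fine (lev L k) M) × o) (Tor (fine (lev L k) M) × o) ℂ} {r : ℝ} {e₀ e₁ f e₂ δT : ℕ → ℝ}
    {κs α β β' τ : ℝ}
    (hfreeS : FreeTowerLaws (fun k => DeltaPs (lev L k) M a' ⊗ₖ (1 : Matrix o o ℂ)) A (J0 L M o) F r e₀ e₁ f)
    (hpertS : PerturbationLaws (fun k => DeltaPs (lev L k) M a' ⊗ₖ (1 : Matrix o o ℂ))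
      (fun k => scalarPert (lev L k) M a' (Rg k) (T k)) (J0 L M o) κs e₂)
    (hκ : κs < 1) (hα : 0 ≤ α) (hβ : 0 ≤ β) (hβ' : 0 ≤ β') (hτ : 0 ≤ τ)
    (hR : ∀ k μ i, ‖connL (fine (lev L k) M) (cl L k) (Rg k) μ i‖ ≤ α)
    (hLip : ∀ k μ lam i, ‖connL (fine (lev L k) M) (cl L k) (Rg k) μ (tau (fine (lev L k) M) lam i)
      - connL (fine (lev L k) M) (cl L k) (Rg k) μ i‖ ≤ β / (lev L k : ℕ))
    (hcons : ∀ k μ (i' : Tor (fine (lev L (k + 1)) M) × Fin d),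
      ‖connL (fine (lev L (k + 1)) M) (cl L (k + 1)) (Rg (k + 1)) μ i'
        - connL (fine (lev L k) M) (cl L k) (Rg k) μ (parT (lev L k) L M i')‖ ≤ β' / (lev L k : ℕ))
    (hT : ∀ k, ‖siteMul (T k) - 1‖ ≤ τ)
    (hTc : ∀ k, ‖siteMul (T (k + 1)) - siteMul (fun x' : Tor (fine (lev L (k + 1)) M) => T k (par (lev L k) L M x'))‖ ≤ δT k)
    (hsmall : nS d a' * deltaK (gS d a' κs) (1 + τ) (d * α) τ a' < 1)
    {C₀ C₁ C₂ CT : ℝ} (he₀ : ∀ k, e₀ k ≤ C₀ * ((L : ℝ)⁻¹) ^ k) (he₁ : ∀ k, e₁ k ≤ C₁ * ((L : ℝ)⁻¹) ^ k)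
    (he₂ : ∀ k, e₂ k ≤ C₂ * ((L : ℝ)⁻¹) ^ k) (hδT : ∀ k, δT k ≤ CT * ((L : ℝ)⁻¹) ^ k) :
    PerturbationLaws (fun k => calDalev L M a ha k ⊗ₖ (1 : Matrix o o ℂ))
      (balabanPert L M a (liftR L M Rg) (gaugeSlot L M Rg (QuT L M o T) (Q1 L M o) a'))
      (fun k => JpcT L M k ⊗ₖ (1 : Matrix o o ℂ)) (kappaBs o d a α₅ β₅ (kappaQ d a (a : ℂ) ε) (kappa4S d a a' κs α τ))
      (fun k => C2Bs o d L a α₅ β₅ C (a * C2gram (Cst d a) 1 ε (2 * d * Cst d a) (CJ d a) (Cst d a) Cδ)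
        (C4S d L a a' κs α β β' τ C₀ C₁ C₂ CT) * ((L : ℝ)⁻¹) ^ k) :=
  perturbationLaws_balaban_sharp L M a ha hd hreg hC hNE3 hε hE
    (perturbationLaws_gaugeSlot_balaban L M a ha hd ha' hfreeS hpertS hκ hα hβ hβ' hτ hR hLip hcons hT hTc hsmall he₀ he₁ he₂ hδT)

/-- **ROOT B AT `t = 1` WITH THE GAUGE SLOT DISCHARGED, SHARP THRESHOLD** (`L ≥ 2`, `d ≥ 1`): `α₅, β₅, ε, κ₄ ≤ η ≤ 1` and
`η·KstarR(card o, d, a) < 1` (NO smallness asked of NE3's constant `C ≥ 0`) ⟹ the lifted King-averaged unit-lattice covariances of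
`(Δ_a^{(k)} ⊗ 1 + P_k)⁻¹` CONVERGE with rate `L^{−k}`; CONDITIONAL as displayed.  NE2 is NOT proved by this. [folklore] -/
theorem balaban_closure_rate_of_small_sharp (hL : 2 ≤ L) (hd : 1 ≤ d)
    {Rg : (k : ℕ) → Fin d → (Tor (fine (lev L k) M) → Matrix o o ℂ)}
    {α₅ β₅ : ℝ} (hreg : RegularTransporters L M (liftR L M Rg) α₅ β₅) {C : ℝ} (hC : 0 ≤ C)
    (hNE3 : LocalRate (bgReadings L M (regClass L M (liftR L M Rg))) C ((L : ℝ)⁻¹)) {ε Cδ : ℝ} (hε : 0 ≤ ε)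
    (hE : AveragingLaws (fun k => calDalev L M a ha k ⊗ₖ (1 : Matrix o o ℂ)) (Ecov L M (liftR L M Rg))
      (fun k => JpcT L M k ⊗ₖ (1 : Matrix o o ℂ)) ε (fun k => Cδ * ((L : ℝ)⁻¹) ^ k))
    {T : (k : ℕ) → Tor (fine (lev L k) M) → Matrix o o ℂ} {a' : ℝ} (ha' : 0 < a')
    {A : (k : ℕ) → Matrix (Tor (fine (lev L k) M) × o) (Tor (fine (lev L (k + 1)) M) × o) ℂ}
    {F : (k : ℕ) → Matrix (Tor (fine (lev L k) M) × o) (Tor (fine (lev L k) M) × o) ℂ} {r : ℝ} {e₀ e₁ f e₂ δT : ℕ → ℝ}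
    {κs α β β' τ : ℝ}
    (hfreeS : FreeTowerLaws (fun k => DeltaPs (lev L k) M a' ⊗ₖ (1 : Matrix o o ℂ)) A (J0 L M o) F r e₀ e₁ f)
    (hpertS : PerturbationLaws (fun k => DeltaPs (lev L k) M a' ⊗ₖ (1 : Matrix o o ℂ))
      (fun k => scalarPert (lev L k) M a' (Rg k) (T k)) (J0 L M o) κs e₂)
    (hκ : κs < 1) (hα : 0 ≤ α) (hβ : 0 ≤ β) (hβ' : 0 ≤ β') (hτ : 0 ≤ τ)
    (hR : ∀ k μ i, ‖connL (fine (lev L k) M) (cl L k) (Rg k) μ i‖ ≤ α)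
    (hLip : ∀ k μ lam i, ‖connL (fine (lev L k) M) (cl L k) (Rg k) μ (tau (fine (lev L k) M) lam i)
      - connL (fine (lev L k) M) (cl L k) (Rg k) μ i‖ ≤ β / (lev L k : ℕ))
    (hcons : ∀ k μ (i' : Tor (fine (lev L (k + 1)) M) × Fin d),
      ‖connL (fine (lev L (k + 1)) M) (cl L (k + 1)) (Rg (k + 1)) μ i'
        - connL (fine (lev L k) M) (cl L k) (Rg k) μ (parT (lev L k) L M i')‖ ≤ β' / (lev L k : ℕ))
    (hT : ∀ k, ‖siteMul (T k) - 1‖ ≤ τ)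
    (hTc : ∀ k, ‖siteMul (T (k + 1)) - siteMul (fun x' : Tor (fine (lev L (k + 1)) M) => T k (par (lev L k) L M x'))‖ ≤ δT k)
    (hsmall : nS d a' * deltaK (gS d a' κs) (1 + τ) (d * α) τ a' < 1)
    {C₀ C₁ C₂ CT : ℝ} (he₀ : ∀ k, e₀ k ≤ C₀ * ((L : ℝ)⁻¹) ^ k) (he₁ : ∀ k, e₁ k ≤ C₁ * ((L : ℝ)⁻¹) ^ k)
    (he₂ : ∀ k, e₂ k ≤ C₂ * ((L : ℝ)⁻¹) ^ k) (hδT : ∀ k, δT k ≤ CT * ((L : ℝ)⁻¹) ^ k)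
    {η : ℝ} (hαη : α₅ ≤ η) (hβη : β₅ ≤ η) (hεη : ε ≤ η) (hκη : kappa4S d a a' κs α τ ≤ η) (hη1 : η ≤ 1)
    (hηK : η * KstarR o d a < 1) :
    TowerLimitRate (fun k => Qlev L M k ⊗ₖ (1 : Matrix o o ℂ)) ((L : ℝ) ^ d)
      (fun k => (calDalev L M a ha k ⊗ₖ (1 : Matrix o o ℂ)
        + balabanPert L M a (liftR L M Rg) (gaugeSlot L M Rg (QuT L M o T) (Q1 L M o) a') k)⁻¹)
      (Cpert (kappaBs o d a α₅ β₅ (a * (ε * (2 + ε) * Cst d a)) (kappa4S d a a' κs α τ)) (2 * d * Cst d a) (CJ d a)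
        (C2Bs o d L a α₅ β₅ C (a * C2gram (Cst d a) 1 ε (2 * d * Cst d a) (CJ d a) (Cst d a) Cδ)
          (C4S d L a a' κs α β β' τ C₀ C₁ C₂ CT)) 0 1) ((L : ℝ)⁻¹) :=
  balaban_rate_of_small_sharp L M a ha hL hd hreg hC hNE3 hε hE
    (perturbationLaws_gaugeSlot_balaban L M a ha hd ha' hfreeS hpertS hκ hα hβ hβ' hτ hR hLip hcons hT hTc hsmall he₀ he₁ he₂ hδT)
    hαη hβη hεη hκη hη1 hηK

/-! ## §3 ROOT B with `hE` discharged: the wired statements -/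

/-- **ROW B7 WIRED — `PerturbationLaws` FOR BAŁABAN's TYPED OPERATOR WITH THE TRANSPORT-ERROR LAWS AND THE GAUGE SLOT DISCHARGED**:
the target shape for `balabanPert (liftR Rg) (gaugeSlot Rg (QuT T) Q1 a′)` with `κ = kappaBs o d a α₅ β₅ (kappaQ d a a (epsR o d α₅))
(kappa4S …)` and `C₂ = C2Bs … (a·C2gram … (epsR …) … (CdeltaR o d a α₅ θ₀)) (C4S …)`.  DISPLAYED BINDERS ONLY: `hreg` (row B5's class,
c3), `hNE3` (node NE3 BY NAME on `{w, Dw}`, c2/c7), `hθg` (numeric: leaf-06's geometric bound of `thetaC`), the scalar tower's laws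
`hfreeS` (row B4.d) / `hpertS` (row B4.e), the sizes and geometric bounds of row B4.b's END, `σ₀⁻²·δK < 1` (c4).  NE2 is NOT proved by
this. [cite: Balaban1985BackgroundPropagators, (3.26) p.395 (shape)] [folklore] -/
theorem perturbationLaws_balaban_wired (hd : 1 ≤ d) {Rg : (k : ℕ) → Fin d → (Tor (fine (lev L k) M) → Matrix o o ℂ)}
    {α₅ β₅ : ℝ} (hreg : RegularTransporters L M (liftR L M Rg) α₅ β₅) {C : ℝ} (hC : 0 ≤ C)
    (hNE3 : LocalRate (bgReadings L M (regClass L M (liftR L M Rg))) C ((L : ℝ)⁻¹))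
    {θ₀ : ℝ} (hθg : ∀ k, thetaR o d L α₅ C k ≤ θ₀ * ((L : ℝ)⁻¹) ^ k)
    {T : (k : ℕ) → Tor (fine (lev L k) M) → Matrix o o ℂ} {a' : ℝ} (ha' : 0 < a')
    {A : (k : ℕ) → Matrix (Tor (fine (lev L k) M) × o) (Tor (fine (lev L (k + 1)) M) × o) ℂ}
    {F : (k : ℕ) → Matrix (Tor (fine (lev L k) M) × o) (Tor (fine (lev L k) M) × o) ℂ} {r : ℝ} {e₀ e₁ f e₂ δT : ℕ → ℝ}
    {κs α β β' τ : ℝ}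
    (hfreeS : FreeTowerLaws (fun k => DeltaPs (lev L k) M a' ⊗ₖ (1 : Matrix o o ℂ)) A (J0 L M o) F r e₀ e₁ f)
    (hpertS : PerturbationLaws (fun k => DeltaPs (lev L k) M a' ⊗ₖ (1 : Matrix o o ℂ))
      (fun k => scalarPert (lev L k) M a' (Rg k) (T k)) (J0 L M o) κs e₂)
    (hκ : κs < 1) (hα : 0 ≤ α) (hβ : 0 ≤ β) (hβ' : 0 ≤ β') (hτ : 0 ≤ τ)
    (hR : ∀ k μ i, ‖connL (fine (lev L k) M) (cl L k) (Rg k) μ i‖ ≤ α)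
    (hLip : ∀ k μ lam i, ‖connL (fine (lev L k) M) (cl L k) (Rg k) μ (tau (fine (lev L k) M) lam i)
      - connL (fine (lev L k) M) (cl L k) (Rg k) μ i‖ ≤ β / (lev L k : ℕ))
    (hcons : ∀ k μ (i' : Tor (fine (lev L (k + 1)) M) × Fin d),
      ‖connL (fine (lev L (k + 1)) M) (cl L (k + 1)) (Rg (k + 1)) μ i'
        - connL (fine (lev L k) M) (cl L k) (Rg k) μ (parT (lev L k) L M i')‖ ≤ β' / (lev L k : ℕ))
    (hT : ∀ k, ‖siteMul (T k) - 1‖ ≤ τ)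
    (hTc : ∀ k, ‖siteMul (T (k + 1)) - siteMul (fun x' : Tor (fine (lev L (k + 1)) M) => T k (par (lev L k) L M x'))‖ ≤ δT k)
    (hsmall : nS d a' * deltaK (gS d a' κs) (1 + τ) (d * α) τ a' < 1)
    {C₀ C₁ C₂ CT : ℝ} (he₀ : ∀ k, e₀ k ≤ C₀ * ((L : ℝ)⁻¹) ^ k) (he₁ : ∀ k, e₁ k ≤ C₁ * ((L : ℝ)⁻¹) ^ k)
    (he₂ : ∀ k, e₂ k ≤ C₂ * ((L : ℝ)⁻¹) ^ k) (hδT : ∀ k, δT k ≤ CT * ((L : ℝ)⁻¹) ^ k) :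
    PerturbationLaws (fun k => calDalev L M a ha k ⊗ₖ (1 : Matrix o o ℂ))
      (balabanPert L M a (liftR L M Rg) (gaugeSlot L M Rg (QuT L M o T) (Q1 L M o) a'))
      (fun k => JpcT L M k ⊗ₖ (1 : Matrix o o ℂ))
      (kappaBs o d a α₅ β₅ (kappaQ d a (a : ℂ) (epsR o d α₅)) (kappa4S d a a' κs α τ))
      (fun k => C2Bs o d L a α₅ β₅ C
        (a * C2gram (Cst d a) 1 (epsR o d α₅) (2 * d * Cst d a) (CJ d a) (Cst d a) (CdeltaR o d a α₅ θ₀))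
        (C4S d L a a' κs α β β' τ C₀ C₁ C₂ CT) * ((L : ℝ)⁻¹) ^ k) :=
  perturbationLaws_balaban_closure_sharp L M a ha hd hreg hC hNE3 (epsR_nonneg (o := o) (d := d) hreg.nonneg.1)
    (averagingLaws_Ecov_of_regular L M a ha hreg hC hNE3 hθg)
    ha' hfreeS hpertS hκ hα hβ hβ' hτ hR hLip hcons hT hTc hsmall he₀ he₁ he₂ hδT

/-- **ROW B7 WIRED — ROOT B AT `t = 1`, SHARP EXPLICIT THRESHOLD** (`L ≥ 2`, `d ≥ 1`): `α₅, β₅, epsR o d α₅, κ₄ ≤ η ≤ 1` and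
`η·KstarR(card o, d, a) < 1` ⟹ the lifted King-averaged unit-lattice covariances of `(Δ_a^{(k)} ⊗ 1 + P_k)⁻¹`, `P` the model of
`Δ_a(U) − Δ_a ⊗ 1` on one background, CONVERGE with rate `L^{−k}` — CONDITIONAL on node NE3 (`hNE3`, OPEN), the regularity class (`hreg`),
the numeric bound `hθg`, the scalar tower's laws (rows B4.d/B4.e) and the displayed sizes.  NOT [B9] (3.23)–(3.26) as printed; NE2 is NOT
proved by this. [folklore] -/
theorem balaban_wired_rate_of_small (hL : 2 ≤ L) (hd : 1 ≤ d)
    {Rg : (k : ℕ) → Fin d → (Tor (fine (lev L k) M) → Matrix o o ℂ)}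
    {α₅ β₅ : ℝ} (hreg : RegularTransporters L M (liftR L M Rg) α₅ β₅) {C : ℝ} (hC : 0 ≤ C)
    (hNE3 : LocalRate (bgReadings L M (regClass L M (liftR L M Rg))) C ((L : ℝ)⁻¹))
    {θ₀ : ℝ} (hθg : ∀ k, thetaR o d L α₅ C k ≤ θ₀ * ((L : ℝ)⁻¹) ^ k)
    {T : (k : ℕ) → Tor (fine (lev L k) M) → Matrix o o ℂ} {a' : ℝ} (ha' : 0 < a')
    {A : (k : ℕ) → Matrix (Tor (fine (lev L k) M) × o) (Tor (fine (lev L (k + 1)) M) × o) ℂ}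
    {F : (k : ℕ) → Matrix (Tor (fine (lev L k) M) × o) (Tor (fine (lev L k) M) × o) ℂ} {r : ℝ} {e₀ e₁ f e₂ δT : ℕ → ℝ}
    {κs α β β' τ : ℝ}
    (hfreeS : FreeTowerLaws (fun k => DeltaPs (lev L k) M a' ⊗ₖ (1 : Matrix o o ℂ)) A (J0 L M o) F r e₀ e₁ f)
    (hpertS : PerturbationLaws (fun k => DeltaPs (lev L k) M a' ⊗ₖ (1 : Matrix o o ℂ))
      (fun k => scalarPert (lev L k) M a' (Rg k) (T k)) (J0 L M o) κs e₂)
    (hκ : κs < 1) (hα : 0 ≤ α) (hβ : 0 ≤ β) (hβ' : 0 ≤ β') (hτ : 0 ≤ τ)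
    (hR : ∀ k μ i, ‖connL (fine (lev L k) M) (cl L k) (Rg k) μ i‖ ≤ α)
    (hLip : ∀ k μ lam i, ‖connL (fine (lev L k) M) (cl L k) (Rg k) μ (tau (fine (lev L k) M) lam i)
      - connL (fine (lev L k) M) (cl L k) (Rg k) μ i‖ ≤ β / (lev L k : ℕ))
    (hcons : ∀ k μ (i' : Tor (fine (lev L (k + 1)) M) × Fin d),
      ‖connL (fine (lev L (k + 1)) M) (cl L (k + 1)) (Rg (k + 1)) μ i'
        - connL (fine (lev L k) M) (cl L k) (Rg k) μ (parT (lev L k) L M i')‖ ≤ β' / (lev L k : ℕ))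
    (hT : ∀ k, ‖siteMul (T k) - 1‖ ≤ τ)
    (hTc : ∀ k, ‖siteMul (T (k + 1)) - siteMul (fun x' : Tor (fine (lev L (k + 1)) M) => T k (par (lev L k) L M x'))‖ ≤ δT k)
    (hsmall : nS d a' * deltaK (gS d a' κs) (1 + τ) (d * α) τ a' < 1)
    {C₀ C₁ C₂ CT : ℝ} (he₀ : ∀ k, e₀ k ≤ C₀ * ((L : ℝ)⁻¹) ^ k) (he₁ : ∀ k, e₁ k ≤ C₁ * ((L : ℝ)⁻¹) ^ k)
    (he₂ : ∀ k, e₂ k ≤ C₂ * ((L : ℝ)⁻¹) ^ k) (hδT : ∀ k, δT k ≤ CT * ((L : ℝ)⁻¹) ^ k)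
    {η : ℝ} (hαη : α₅ ≤ η) (hβη : β₅ ≤ η) (hεη : epsR o d α₅ ≤ η) (hκη : kappa4S d a a' κs α τ ≤ η) (hη1 : η ≤ 1)
    (hηK : η * KstarR o d a < 1) :
    TowerLimitRate (fun k => Qlev L M k ⊗ₖ (1 : Matrix o o ℂ)) ((L : ℝ) ^ d)
      (fun k => (calDalev L M a ha k ⊗ₖ (1 : Matrix o o ℂ)
        + balabanPert L M a (liftR L M Rg) (gaugeSlot L M Rg (QuT L M o T) (Q1 L M o) a') k)⁻¹)
      (Cpert (kappaBs o d a α₅ β₅ (a * (epsR o d α₅ * (2 + epsR o d α₅) * Cst d a)) (kappa4S d a a' κs α τ))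
        (2 * d * Cst d a) (CJ d a)
        (C2Bs o d L a α₅ β₅ C
          (a * C2gram (Cst d a) 1 (epsR o d α₅) (2 * d * Cst d a) (CJ d a) (Cst d a) (CdeltaR o d a α₅ θ₀))
          (C4S d L a a' κs α β β' τ C₀ C₁ C₂ CT)) 0 1) ((L : ℝ)⁻¹) :=
  balaban_closure_rate_of_small_sharp L M a ha hL hd hreg hC hNE3 (epsR_nonneg (o := o) (d := d) hreg.nonneg.1)
    (averagingLaws_Ecov_of_regular L M a ha hreg hC hNE3 hθg)
    ha' hfreeS hpertS hκ hα hβ hβ' hτ hR hLip hcons hT hTc hsmall he₀ he₁ he₂ hδT hαη hβη hεη hκη hη1 hηK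

end Summit.QuantumFields.BalabanUV.T4Continuum.NE2BalabanWiring

end
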